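import Literature.NumberTheory.GaloisRepresentations.EisensteinSexticHeckeCharacter
import Literature.NumberTheory.GaloisRepresentations.EisensteinCubicIndex
import HarnessLib

/-!
# Split and inert primes of `ℚ(ω)`, and the ideal character `ψ` of `y² = x³ + k` at rational integers (Ireland–Rosen Ch. 9 §1, Ch. 18 §7)

Topic `Literature/NumberTheory/GaloisRepresentations`, namespace `Literature.NumberTheory.GaloisRepresentations.EisensteinSextic` (sequel of
`EisensteinSexticHeckeCharacter`).  THEOREMS only (no definition, no instance, no named fact).  For an abstract `K ∋ ζ₃`
(`{ζ : 𝓞 K} (hζ : IsPrimitiveRoot ζ 3)`, `IsCyclotomicExtension {3} ℚ K`) and the non-trivial automorphism `c`: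

* §1 the primes above a rational prime `p ≠ 3`: `residueCard_eq_of_mod_three_eq_one` (`p ≡ 1 (3)`, `𝔭 ∋ p ⇒ N𝔭 = p`; Mathlib's cyclotomic
  decomposition law `IsCyclotomicExtension.Rat.inertiaDeg_eq_of_not_dvd`), `asIdeal_eq_span_of_mod_three_eq_two` (`p ≡ 2 (3) ⇒ 𝔭 = (p)`, the
  tree's `EisensteinCubic.span_natCast_eq_of_liesOver`), `smul_eq_self_of_mod_three_eq_two`, `smul_zeta` (`c ζ = ζ²`),
  `exists_zeta_sub_natCast_mem`, ★ `smul_ne_self_of_mod_three_eq_one` (`p ≡ 1 (3) ⇒ c𝔭 ≠ 𝔭`), ★ `eq_of_three_mem` (the prime above `3` is unique);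
* §2 the ideal character of `EisensteinSexticHeckeCharacter.psi` at a rational integer `a ≡ 2 (mod 3)` prime to `6k`:
  `absNorm_span_intCast` (`N((a)) = |a|²`), `isCoprime_span_intCast_modulus`, ★ `idealPow_psi_span_intCast` (`ψ̃((a)) = −S((a))·a`, `S³ = 1`)
  and `idealPow_psi_span_intCast_ne` (`ψ̃((a)) ≠ a`) — the witnesses showing that `ψ` is not `≡ 1` on the local units at `λ = (1 − ω)`
  (Ireland–Rosen's «if `P ∣ 6D` then `χ(P) = 0`» at `P = λ`), used in `EllipticCurves/SexticTwistGrossencharakterFrobenius`.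

Nothing about BSD is proved here.

## References
* K. Ireland, M. Rosen, *A Classical Introduction to Modern Number Theory*, 2nd ed., GTM 84 (1990), Ch. 9 §1 Prop. 9.1.4, §2; Ch. 18 §6
  Theorem 7, §7. [IrelandRosen1990]
* J. Neukirch, *Algebraic Number Theory* (1999), Ch. I §8. [NeukirchANT1999]
* J. H. Silverman, *Advanced Topics in the Arithmetic of Elliptic Curves* (1994), II Thm. 10.5. [SilvermanATAEC1994]

## Mathlib / tree search
Tree: `EisensteinSexticPrimes`/`EisensteinSexticHeckeCharacter` (`psi`, `modulus`, `cubicLoc`, `varpi`, `idealPow_psi_span`, `hsurj_three`, `hinj_three`,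
`artinSymbol_cubicLoc_pow_three`, `algEquiv_eq_of_ne_one`, `smul_intCast`, `intCast_mem_smul_iff`, `smul_span_singleton`); `EisensteinCubic.{span_natCast_eq_of_liesOver,
absNorm_span_natCast', finrank_int_ringOfIntegers, prime_zeta_sub_one}` (`EisensteinCubicIndex`); `exists_aut_apply_eq_sq`, `three_not_mem_of_natCast_mem`
(`CubicReciprocityRationalPrime`); `three_mem_span_one_sub`, `sq_add_self_add_one_eq_zero` (`CubicResidueSymbol`); `primarize_eq_of` (`PrimaryGeneratorHeckeCharacter`).
Mathlib: `IsCyclotomicExtension.Rat.inertiaDeg_eq_of_not_dvd`, `Ideal.pow_inertiaDeg`, `Ideal.liesOver_iff`, `ZMod.ringEquivOfPrime`, `Algebra.norm_algebraMap`,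
`jacobiSym.{pow_right, sq_one}`, `Ideal.isCoprime_span_singleton_iff`.
-/

noncomputable section

open NumberField IsDedekindDomain IsDedekindDomain.HeightOneSpectrum
open scoped NumberTheorySymbols ComplexConjugate Pointwise

namespace Literature.NumberTheory.GaloisRepresentations.EisensteinSextic

open Literature.NumberTheory.GaloisRepresentations
open Literature.NumberTheory.LFunctions (idealPow isCoprime_span_of_sub_mem)
open Literature.NumberTheory.LFunctions.AbelianDensity (artinSymbol artinSymbol_asIdeal idealPow_comp_eq)
open Literature.NumberTheory.Automorphic (RingOfIntegers.coe_algEquiv_smul HeightOneSpectrum.smul_mem_smul_asIdeal_iff)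

variable {K : Type*} [Field K] [NumberField K] {ζ : 𝓞 K} (hζ : IsPrimitiveRoot ζ 3)

/-! ### §1 The primes of `ℚ(ω)` above a rational prime `p ≠ 3`: split (`p ≡ 1`) and inert (`p ≡ 2 (mod 3)`) -/

section PlacesB

variable [IsCyclotomicExtension {3} ℚ K]

omit [NumberField K] [IsCyclotomicExtension {3} ℚ K] in
/-- `𝔭 ∋ p` lies over `pℤ`. [folklore] -/
private theorem liesOver_of_natCast_mem {p : ℕ} (hp : p.Prime) {v : HeightOneSpectrum (𝓞 K)} (hv : (p : 𝓞 K) ∈ v.asIdeal) :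
    v.asIdeal.LiesOver (Ideal.span {(p : ℤ)}) := by
  haveI := Fact.mk hp
  rw [Ideal.liesOver_iff]
  refine Ideal.IsMaximal.eq_of_le (Int.ideal_span_isMaximal_of_prime p) Ideal.IsPrime.ne_top' ?_
  rw [Ideal.span_singleton_le_iff_mem, Ideal.mem_comap, algebraMap_int_eq, map_natCast]
  exact hv

omit [IsCyclotomicExtension {3} ℚ K] in
/-- Two distinct rational primes do not lie in a common prime of `𝓞 K`. [cite: NeukirchANT1999, Ch. I §8] -/
theorem natCast_not_mem_of_natCast_mem {p q : ℕ} (hp : p.Prime) (hq : q.Prime) (hpq : p ≠ q) {v : HeightOneSpectrum (𝓞 K)}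
    (hv : (p : 𝓞 K) ∈ v.asIdeal) : (q : 𝓞 K) ∉ v.asIdeal := by
  intro hq'
  obtain ⟨a, b, hab⟩ := (Nat.coprime_primes hp hq).mpr hpq |>.isCoprime
  have h1 : (1 : 𝓞 K) = (a : 𝓞 K) * p + (b : 𝓞 K) * q := by exact_mod_cast hab.symm
  exact v.isPrime.ne_top ((Ideal.eq_top_iff_one _).mpr (h1 ▸ v.asIdeal.add_mem (v.asIdeal.mul_mem_left _ hv) (v.asIdeal.mul_mem_left _ hq')))

/-- **Split primes have degree one**: for `p ≡ 1 (mod 3)` and `𝔭 ∋ p`, `N𝔭 = p` (Mathlib's cyclotomic decomposition law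
`inertiaDeg_eq_of_not_dvd`: `f = ord₃ p = 1`). [cite: IrelandRosen1990, Ch. 9 §1 Prop. 9.1.4] -/
theorem residueCard_eq_of_mod_three_eq_one {p : ℕ} (hp : p.Prime) (hp3 : p % 3 = 1) {v : HeightOneSpectrum (𝓞 K)}
    (hv : (p : 𝓞 K) ∈ v.asIdeal) : v.residueCard = p := by
  haveI := Fact.mk hp
  haveI := liesOver_of_natCast_mem hp hv
  have hp3' : ¬ p ∣ 3 := fun h => by
    have := (Nat.prime_dvd_prime_iff_eq hp Nat.prime_three).mp h; subst this; norm_num at hp3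
  have hf : v.asIdeal.inertiaDeg ℤ = 1 := by
    rw [IsCyclotomicExtension.Rat.inertiaDeg_eq_of_not_dvd (m := 3) p K v.asIdeal hp3', orderOf_eq_one_iff]
    have h := ZMod.natCast_mod p 3
    rw [hp3, Nat.cast_one] at h
    exact h.symm
  show Ideal.absNorm v.asIdeal = p
  rw [← Ideal.pow_inertiaDeg p v.asIdeal, hf, pow_one]

/-- **Inert primes**: for `p ≡ 2 (mod 3)` and `𝔭 ∋ p`, `𝔭 = (p)` (the tree's `EisensteinCubic.span_natCast_eq_of_liesOver`).
[cite: IrelandRosen1990, Ch. 9 §1 Prop. 9.1.4] -/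
theorem asIdeal_eq_span_of_mod_three_eq_two {p : ℕ} (hp : p.Prime) (hp3 : p % 3 = 2) {v : HeightOneSpectrum (𝓞 K)}
    (hv : (p : 𝓞 K) ∈ v.asIdeal) : v.asIdeal = Ideal.span {(p : 𝓞 K)} := by
  haveI := liesOver_of_natCast_mem hp hv
  exact (EisensteinCubic.span_natCast_eq_of_liesOver hp hp3 v.asIdeal).symm

/-- An inert prime is fixed by the automorphisms: `c • (p) = (p)`. [cite: IrelandRosen1990, Ch. 9 §1 Prop. 9.1.4] -/
theorem smul_eq_self_of_mod_three_eq_two (c : K ≃ₐ[ℚ] K) {p : ℕ} (hp : p.Prime) (hp3 : p % 3 = 2)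
    {v : HeightOneSpectrum (𝓞 K)} (hv : (p : 𝓞 K) ∈ v.asIdeal) : c • v = v := by
  apply HeightOneSpectrum.ext
  rw [Literature.NumberTheory.Automorphic.HeightOneSpectrum.smul_asIdeal, asIdeal_eq_span_of_mod_three_eq_two hp hp3 hv,
    smul_span_singleton]
  have h := smul_intCast c (p : ℤ)
  rw [Int.cast_natCast] at h
  rw [h]

include hζ in
/-- The non-trivial automorphism squares `ζ`: `c • ζ = ζ²` (the tree's `exists_aut_apply_eq_sq` and uniqueness of `c`). [cite: IrelandRosen1990, Ch. 9 §1] -/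
theorem smul_zeta {c : K ≃ₐ[ℚ] K} (hc : c ≠ 1) : c • ζ = ζ ^ 2 := by
  obtain ⟨σ, hσ1, hσ⟩ := exists_aut_apply_eq_sq hζ
  rw [algEquiv_eq_of_ne_one hc hσ1]
  apply RingOfIntegers.ext
  rw [RingOfIntegers.coe_algEquiv_smul ℚ]
  exact_mod_cast hσ ζ (Or.inr hζ.pow_eq_one)

omit [IsCyclotomicExtension {3} ℚ K] in
/-- At a prime of degree one every integer is congruent to a rational integer: `ζ ≡ x (mod 𝔭)` for some `x ∈ ℕ`.
[cite: IrelandRosen1990, Ch. 9 §2 Prop. 9.2.1] -/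
theorem exists_zeta_sub_natCast_mem {p : ℕ} (hp : p.Prime) {v : HeightOneSpectrum (𝓞 K)} (hN : v.residueCard = p) :
    ∃ x : ℕ, ζ - (x : 𝓞 K) ∈ v.asIdeal := by
  letI := Ideal.Quotient.field v.asIdeal
  letI := Fintype.ofFinite (𝓞 K ⧸ v.asIdeal)
  have hcard : Fintype.card (𝓞 K ⧸ v.asIdeal) = p := by
    rw [← Nat.card_eq_fintype_card, ← HeightOneSpectrum.residueCard_eq_card_quotient, hN]
  set f := ZMod.ringEquivOfPrime (𝓞 K ⧸ v.asIdeal) hp hcard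
  refine ⟨(f.symm (Ideal.Quotient.mk v.asIdeal ζ)).val, ?_⟩
  rw [← Ideal.Quotient.eq, map_natCast]
  have h := f.apply_symm_apply (Ideal.Quotient.mk v.asIdeal ζ)
  haveI := Fact.mk hp
  conv_lhs => rw [← h, ← ZMod.natCast_zmod_val (f.symm (Ideal.Quotient.mk v.asIdeal ζ)), map_natCast]

include hζ in
/-- **A split prime is moved by the non-trivial automorphism**: for `p ≡ 1 (mod 3)` and `𝔭 ∋ p`, `c • 𝔭 ≠ 𝔭` (if `c𝔭 = 𝔭` then with
`ζ ≡ x (mod 𝔭)` also `ζ² ≡ x`, so `ζ(ζ − 1) ∈ 𝔭` and `3 ∈ 𝔭`). [cite: IrelandRosen1990, Ch. 9 §1 Prop. 9.1.4] -/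
theorem smul_ne_self_of_mod_three_eq_one {c : K ≃ₐ[ℚ] K} (hc : c ≠ 1) {p : ℕ} (hp : p.Prime) (hp3 : p % 3 = 1)
    {v : HeightOneSpectrum (𝓞 K)} (hv : (p : 𝓞 K) ∈ v.asIdeal) : c • v ≠ v := by
  intro hcv
  have h3v : (3 : 𝓞 K) ∉ v.asIdeal := three_not_mem_of_natCast_mem hv (by
    rw [Nat.coprime_comm, Nat.Prime.coprime_iff_not_dvd Nat.prime_three]; omega)
  obtain ⟨x, hx⟩ := exists_zeta_sub_natCast_mem hp (residueCard_eq_of_mod_three_eq_one hp hp3 hv)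
  -- apply `c`: `ζ² − x ∈ c • 𝔭 = 𝔭`
  have hx2 : ζ ^ 2 - (x : 𝓞 K) ∈ v.asIdeal := by
    have h := (HeightOneSpectrum.smul_mem_smul_asIdeal_iff c v (ζ - (x : 𝓞 K))).mpr hx
    rw [hcv, smul_sub, smul_zeta hζ hc] at h
    have hxn := smul_intCast c (x : ℤ)
    rw [Int.cast_natCast] at hxn
    rwa [hxn] at h
  have hζζ : ζ * (ζ - 1) ∈ v.asIdeal := by
    have : ζ * (ζ - 1) = (ζ ^ 2 - (x : 𝓞 K)) - (ζ - (x : 𝓞 K)) := by ring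
    rw [this]; exact v.asIdeal.sub_mem hx2 hx
  rcases v.isPrime.mem_or_mem hζζ with h | h
  · exact v.isPrime.ne_top (v.asIdeal.eq_top_of_isUnit_mem h (hζ.isUnit (by norm_num)))
  · apply h3v
    have h1 : (1 : 𝓞 K) - ζ ∈ v.asIdeal := by rw [show (1 : 𝓞 K) - ζ = -(ζ - 1) by ring]; exact v.asIdeal.neg_mem h
    exact (Ideal.span_singleton_le_iff_mem _).mpr h1 (three_mem_span_one_sub hζ)

include hζ in
/-- **The prime above `3` is unique** (`(3) = (1 − ζ)²`, `1 − ζ` prime). [cite: IrelandRosen1990, Ch. 9 §1 Prop. 9.1.4 (a)] -/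
theorem eq_of_three_mem {v w : HeightOneSpectrum (𝓞 K)} (hv : (3 : 𝓞 K) ∈ v.asIdeal) (hw : (3 : 𝓞 K) ∈ w.asIdeal) : v = w := by
  obtain ⟨hprime, h3⟩ := EisensteinCubic.prime_zeta_sub_one hζ
  have key : ∀ u : HeightOneSpectrum (𝓞 K), (3 : 𝓞 K) ∈ u.asIdeal → u.asIdeal = Ideal.span {ζ - 1} := by
    intro u hu
    have hmem : ζ - 1 ∈ u.asIdeal := by
      rw [h3, show -(ζ - 1) ^ 2 * ζ ^ 2 = (ζ - 1) * ((ζ - 1) * (-ζ ^ 2)) by ring] at hu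
      rcases u.isPrime.mem_or_mem hu with h | h
      · exact h
      rcases u.isPrime.mem_or_mem h with h | h
      · exact h
      · exact absurd (u.asIdeal.eq_top_of_isUnit_mem h ((hζ.isUnit (by norm_num)).pow 2).neg) u.isPrime.ne_top
    have hmax : (Ideal.span {ζ - 1}).IsMaximal :=
      (Ideal.span_singleton_prime hprime.ne_zero |>.mpr hprime).isMaximal (by rw [Ne, Ideal.span_singleton_eq_bot]; exact hprime.ne_zero)
    exact (hmax.eq_of_le u.isPrime.ne_top ((Ideal.span_singleton_le_iff_mem _).mpr hmem)).symm
  exact HeightOneSpectrum.ext (by rw [key v hv, key w hw])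

end PlacesB

/-! ### §2 The ideal character at rational integers `a ≡ 2 (mod 3)` prime to `6k` (the witnesses at `λ`) -/

section WitnessB

variable [IsCyclotomicExtension {3} ℚ K]

/-- `N((a)) = |a|²` for a rational integer `a` (`[𝓞 K : ℤ] = 2`). [cite: IrelandRosen1990, Ch. 9 §1 (`N(a) = a²` for `a ∈ ℤ`)] -/
theorem absNorm_span_intCast (a : ℤ) : Ideal.absNorm (Ideal.span {(a : 𝓞 K)}) = a.natAbs ^ 2 := by
  rw [Ideal.absNorm_span_singleton, show ((a : ℤ) : 𝓞 K) = algebraMap ℤ (𝓞 K) a from (eq_intCast (algebraMap ℤ (𝓞 K)) a).symm,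
    Algebra.norm_algebraMap, EisensteinCubic.finrank_int_ringOfIntegers, Int.natAbs_pow]

omit [NumberField K] [IsCyclotomicExtension {3} ℚ K] in
/-- `(a)` is prime to `(36k)` when `(a, 6k) = 1` in `ℤ`. [cite: IrelandRosen1990, Ch. 18 §6 Theorem 7] -/
theorem isCoprime_span_intCast_modulus {k a : ℤ} (ha : IsCoprime a (6 * k)) :
    IsCoprime (Ideal.span {(a : 𝓞 K)}) (modulus (K := K) k) := by
  have ha36 : IsCoprime a (36 * k) := by
    have h6 : IsCoprime a 6 := ha.of_mul_right_left
    rw [show (36 : ℤ) * k = 6 * (6 * k) by ring]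
    exact h6.mul_right ha
  rw [modulus, Ideal.isCoprime_span_singleton_iff]
  simpa using ha36.map (Int.castRingHom (𝓞 K))

/-- ★ **The ideal character at a rational integer `a ≡ 2 (mod 3)` prime to `6k`**: `ψ̃((a)) = −S((a)) · a` with `S((a))³ = 1`
(`(k/a²) = 1`, and the primary associate of `a` is `−a`).  In particular `ψ̃((a)) ≠ a`: the character is not `≡ 1` on the local units at
`λ` of the ray modulo `(36k)` — Ireland–Rosen's «if `P ∣ 6D` then `χ(P) = 0`» at `P = (1 − ω)`, uniformly in `k`.
[cite: IrelandRosen1990, Ch. 18 §6 Theorem 7, §7] [cite: SilvermanATAEC1994, II Thm. 10.5 (the conductor of `ψ_{E/K}` contains the bad primes)] -/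
theorem idealPow_psi_span_intCast {k : ℤ} (hk : k ≠ 0) (e : K →+* ℂ) {a : ℤ} (ha3 : a % 3 = 2) (ha : IsCoprime a (6 * k)) :
    idealPow K (psi hζ k e) (Ideal.span {(a : 𝓞 K)}) =
      -(((artinSymbol (cubicLoc hζ ((4 * k : ℤ) : 𝓞 K) e) (Ideal.span {(a : 𝓞 K)}) : ℂˣ) : ℂ) * a) := by
  haveI : IsPrincipalIdealRing (𝓞 K) := IsCyclotomicExtension.Rat.three_pid K
  have ha0 : a ≠ 0 := by rintro rfl; omega
  have ha0' : (a : 𝓞 K) ≠ 0 := by exact_mod_cast ha0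
  have hcop := isCoprime_span_intCast_modulus (K := K) ha
  rw [idealPow_psi_span hζ hk e ha0' hcop]
  -- `(k/|a|²) = 1`
  have hJ : J(k | Ideal.absNorm (Ideal.span {(a : 𝓞 K)})) = 1 := by
    rw [absNorm_span_intCast, jacobiSym.pow_right, jacobiSym.sq_one]
    rw [Int.gcd_eq_natAbs, Int.natAbs_natCast, ← Int.gcd_eq_natAbs]
    exact Int.isCoprime_iff_gcd_eq_one.mp ha.of_mul_right_right.symm
  -- the primary associate of `a` is `−a`
  have h3le : modulus (K := K) k ≤ Ideal.span {(3 : 𝓞 K)} := by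
    rw [modulus]; exact Ideal.span_singleton_le_span_singleton.mpr ⟨((12 * k : ℤ) : 𝓞 K), by push_cast; ring⟩
  have hcop3 : IsCoprime (Ideal.span {(a : 𝓞 K)}) (Ideal.span {(3 : 𝓞 K)}) := by
    rw [Ideal.isCoprime_iff_sup_eq] at hcop ⊢; exact top_le_iff.mp (hcop ▸ sup_le_sup_left h3le _)
  have hprim : primarize (hsurj_three hζ) (a : 𝓞 K) = -(a : 𝓞 K) := by
    refine primarize_eq_of (hsurj_three hζ) (hinj_three hζ) hcop3 (Ideal.span_singleton_neg _) ?_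
    obtain ⟨m, hm⟩ : (3 : ℤ) ∣ a + 1 := by omega
    refine Ideal.mem_span_singleton'.mpr ⟨-(m : 𝓞 K), ?_⟩
    have hm' : (a : 𝓞 K) + 1 = 3 * (m : 𝓞 K) := by exact_mod_cast congrArg (Int.cast (R := 𝓞 K)) hm
    linear_combination hm'
  have hcoe : e (((a : ℤ) : 𝓞 K) : K) = (a : ℂ) := by
    rw [show (((a : ℤ) : 𝓞 K) : K) = (a : K) from map_intCast (algebraMap (𝓞 K) K) a, map_intCast]
  rw [hJ, hprim, Int.cast_one, one_mul]
  push_cast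
  rw [map_neg, hcoe]
  ring

/-- ★ `ψ̃((a)) ≠ a` for such `a` (`S((a))` is a cube root of unity, `−S·a = a` would force `S = −1`). [cite: IrelandRosen1990, Ch. 18 §6 Theorem 7, §7] -/
theorem idealPow_psi_span_intCast_ne {k : ℤ} (hk : k ≠ 0) (e : K →+* ℂ) {a : ℤ} (ha3 : a % 3 = 2) (ha : IsCoprime a (6 * k)) :
    idealPow K (psi hζ k e) (Ideal.span {(a : 𝓞 K)}) ≠ (a : ℂ) := by
  rw [idealPow_psi_span_intCast hζ hk e ha3 ha]
  set S : ℂ := ((artinSymbol (cubicLoc hζ ((4 * k : ℤ) : 𝓞 K) e) (Ideal.span {(a : 𝓞 K)}) : ℂˣ) : ℂ) with hS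
  have hS3 : S ^ 3 = 1 := by rw [hS, ← Units.val_pow_eq_pow_val, artinSymbol_cubicLoc_pow_three, Units.val_one]
  have ha0 : (a : ℂ) ≠ 0 := by exact_mod_cast (show a ≠ 0 by rintro rfl; omega)
  intro h
  have h1 : (S + 1) * a = 0 := by linear_combination (-1 : ℂ) * h
  rcases mul_eq_zero.mp h1 with h2 | h2
  · have : S = -1 := by linear_combination h2
    rw [this] at hS3; norm_num at hS3
  · exact ha0 h2

end WitnessB

end Literature.NumberTheory.GaloisRepresentations.EisensteinSextic

end
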